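/-
Copyright: statement-level skeleton of a published paper (lit-balaban cell, Phase-2 proof seat p25, gen 18). No proof
claims beyond what the kernel checks below.
-/
import Literature.MathematicalPhysics.QuantumFieldTheory.BalabanImbrieJaffe1984to88.BIJ88LabelledRun311

/-!
# `BalabanImbrieJaffe1984to88.BIJ88WalkRun311` — T. Bałaban, J. Imbrie, A. Jaffe, *Effective action and cluster
properties of the abelian Higgs model*, Commun. Math. Phys. **114** (1988) 257–315 [BalabanImbrieJaffe1988], §5.14
p. 311 [PDF 55], verbatim: *"We integrate by parts in the Gaussian expectation (5.14.1). Each F^{m̄}_{k,loc}(X_{σ_i}) is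
a polynomial in A^{(k)}, φ^{(k)}; those fields can be contracted via covariances C^{(k)}_{Λ,Γ} or C^{(k)}(u_{k+1}) to
other observables, to χ′_{Λ^{(k)}}, or to the interaction. After each integration by parts, we replace the covariance
by C^{(k)}_{loc} or C^{(k)}_{loc}(u_{k+1}) and give a random walk expansion for the difference. For each term, let X be
the union of the cubes covering the X_{σ_i} and the regions from the random walk expansion. A connected component of X
is called complete if a contraction to χ′_{Λ^{(k)}} occurs, if a term from the random walk expansion occurs, if at
least m̄+1 interactions have been differentiated down, or if the term is constant (all legs contracted). We stop
integrating by parts fields in complete components of X."* — **THE RUN OF ONE COMPONENT WITH THE COVARIANCE SPLIT AND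
THE RANDOM-WALK TRIGGER.**  The sequel of p25 gen 16's `BIJ88LabelledRun311.run` (one covariance `A⁻¹`, THREE of the
four printed completeness conditions): here EVERY contraction's covariance is written as a finite sum of PIECES
`A⁻¹ = Σ_{p : P} Cov p` — print's `C = C_loc + (C − C_loc)` with the difference expanded, `trig p = false` for the local
piece `C_loc`, `trig p = true` for *"a term from the random walk expansion"* — the component records the pieces its
contractions used (`WGrp.pcs`, whose regions enter `X`) and the vertices it differentiated down (`WGrp.vxs`, whose
localizations enter `X`), and the FOURTH printed condition is booked: a component in which a triggering piece occurred
(`0 < WGrp.nw`) is complete and is no longer integrated by parts.  The analytic identity (nothing is lost, given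
`Σ_p Cov p = A⁻¹`), the environment lemmas and the connectedness of `X` are the sibling files of this generation.

statement-level skeleton of published theorems with citation tags; proofs where landed; nothing here is a claim
about the Yang–Mills mass gap

PDF held: `paper:balaban1988-cmp114-bij-abelian-higgs-effective-action` (journal page = PDF page + 256); p. 311–312 =
PDF 55–56 (`p0055.txt` L23–38, `p0056.txt` L1–9 re-read this session, 2026-08-22).

CITATION HEADER (lean-in-tree rule).  lit-balaban cell (HOME `run/shared/lean/pub/lit-balaban/`), Phase 2, seat p25
gen 18; row **C2.Claim@312** of `HOME/lit-balaban-r16/ROWS-C2-part2.md` (owner r16, referee ref-5; head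
`BIJ88Sect5StatementsPart4.Ineq312` untouched — this file starts the owner's open item (γ): the `C_loc` split with the
random-walk trigger).  USED BY NAME, nothing restated: `BIJ88LabelledRun311.{fbind, mbind}` (p25 gen 16),
`BIJ88VertexComponents311.{maxArity, length_legs_le}` (p25 gen 15).

## What is proved (0 `sorry`, standard axioms, no new `Prop` facts; definitions with bodies: `WGrp`, `WGrp.complete`,
`WGrp.IsConst`, `WGrp.IsRem`, `pristine`, `WGrp.absorb`, `WOut` (+ `scale`/`push`/`bump`), `rpot`, `run`)

* §1 the component with its records (`WGrp`: pending legs, `χ′`-count, vertices, labels, pieces, number of random-walk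
  terms), print's FOUR completeness conditions (`WGrp.complete`), constant / remainder components, outcomes `WOut`.
* §2 the potential `rpot` and its decrease under the six events (`rpot_pair`, `rpot_pristine`, `rpot_absorb`,
  `rpot_drop`, `rpot_vertex`), `WGrp.nv_lt_of_not_complete`, `WGrp.pend_ne_nil_of_not_complete`; **`run`**
  (well-founded on `rpot`): complete ⇒ set aside; otherwise, FOR EVERY PIECE `p`, the head leg contracts through
  `Cov p` (1) within the component, (2) to a leg of a pristine observable [it joins], (3) to a pending leg of a complete
  component set aside [it joins], (4) to the source, (5) to `χ′` [direction `Cov p u`], (6) to a vertex [its other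
  legs join, the vertex is recorded]; every event records `p` and adds `trig p` to the random-walk count, so that a
  random-walk term completes the component; §2b `run_of_complete`, `run_of_not_complete`,
  `WGrp.complete_of_trig`, `WGrp.isConst_or_isRem_of_complete`, `WGrp.not_isConst_of_isRem`.
HONEST SCOPE: (a) components are CONTRACTION-GRAPH components as in gen 15–17 (print's components are the geometric
components of the cube set `X`; with pieces of finite range ours are `R`-connected — sibling `BIJ88WalkGeometry311` —
and print's are unions of ours); (b) the pieces `Cov p`, the trigger `trig` and (in the siblings) their regions are
DATA: print's `C_loc` *"cutting off the kernel when the arguments are separated by O(r(e_k))"* and the random-walk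
expansion of `C − C_loc` are not constructed here (refs. 3–5 of the paper); (c) a fixed order of events inside a
component (head leg first), all `|P|` pieces offered at every contraction including those to the source and to `χ′`;
(d) no estimates and no analysis in this file.  NOT summit progress; NOT continuum; NOT Clay.  Imports
`BIJ88LabelledRun311` only; modifies nothing.
-/

noncomputable section

namespace Literature.MathematicalPhysics.QuantumFieldTheory.BalabanImbrieJaffe1984to88.BIJ88WalkRun311

open Classical Matrix Finset
open scoped BigOperators
open BIJ88VertexComponents311 (maxArity length_legs_le)
open BIJ88LabelledRun311 (fbind mbind)

variable {S : Type} [Fintype S] {ι : Type} [Fintype ι] {κ : Type} {P : Type} [Fintype P]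

/-! ## §1  Components with their records, completeness, outcomes -/

/-- **A component of `X` with its records** (p. 311): the pending legs (head = the next field integrated by parts),
the number of contractions to `χ′`, the vertices differentiated down (their localizations are cubes of `X`), the
observables `F_{k,loc}(X_{σ_i})` merged into it, the covariance pieces used by its contractions (the regions of the
random-walk pieces are cubes of `X`: *"X … the union of the cubes covering the X_{σ_i} and the regions from the random
walk expansion"*), and the number of random-walk terms that occurred. [cite: BalabanImbrieJaffe1988, §5.14 p.311] -/
structure WGrp (S κ ι P : Type) where
  /-- pending legs of the component -/
  pend : List (S → ℝ)
  /-- contractions to `χ′` that occurred in the component -/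
  nchi : ℕ
  /-- the interaction vertices differentiated down in the component (with multiplicity) -/
  vxs : Multiset ι
  /-- the observables (indices) whose legs belong to this component -/
  lab : Finset κ
  /-- the covariance pieces used by the contractions of the component (with multiplicity) -/
  pcs : Multiset P
  /-- the number of random-walk terms (triggering pieces) that occurred in the component -/
  nw : ℕ

/-- **Print's four completeness conditions** (`M = m̄+1`): *"complete if a contraction to χ′ occurs, if a term from
the random walk expansion occurs, if at least m̄+1 interactions have been differentiated down, or if the term is
constant (all legs contracted)"*. [cite: BalabanImbrieJaffe1988, §5.14 p.311] -/
def WGrp.complete (M : ℕ) (g : WGrp S κ ι P) : Bool :=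
  g.pend.isEmpty || decide (0 < g.nchi) || decide (M ≤ Multiset.card g.vxs) || decide (0 < g.nw)

/-- **Constant component**: all legs contracted, no `χ′`, at most `m̄` vertices, no random-walk term (*"The other
components are called constant components {X_c}, since the observable there is independent of A^{(k)}, φ^{(k)}"*).
[cite: BalabanImbrieJaffe1988, §5.14 p.311–312] -/
def WGrp.IsConst (M : ℕ) (g : WGrp S κ ι P) : Prop :=
  g.pend = [] ∧ g.nchi = 0 ∧ Multiset.card g.vxs < M ∧ g.nw = 0

/-- **Remainder component**: *"The components containing contractions to χ′, terms from the random walk expansions,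
or at least m̄+1 interactions are called remainder components {X_r}"*. [cite: BalabanImbrieJaffe1988, §5.14 p.311] -/
def WGrp.IsRem (M : ℕ) (g : WGrp S κ ι P) : Prop :=
  0 < g.nchi ∨ M ≤ Multiset.card g.vxs ∨ 0 < g.nw

/-- The pristine component of the observable `j`: its legs, no `χ′`, no vertex, label `{j}`, no piece, no walk.
[cite: BalabanImbrieJaffe1988, §5.14 p.311] -/
def pristine (obs : κ → List (S → ℝ)) (j : κ) : WGrp S κ ι P := ⟨obs j, 0, 0, {j}, 0, 0⟩

/-- **Two components joined by a contraction through the piece `p`** (the head leg of the first contracts to the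
`i`-th pending leg of the second): legs, counts, vertices, labels and pieces are united, `p` is recorded.
[cite: BalabanImbrieJaffe1988, §5.14 p.311] -/
def WGrp.absorb [DecidableEq κ] (trig : P → Bool) (L : List (S → ℝ)) (g h : WGrp S κ ι P) (i : ℕ) (p : P) :
    WGrp S κ ι P :=
  ⟨L ++ h.pend.eraseIdx i, g.nchi + h.nchi, g.vxs + h.vxs, g.lab ∪ h.lab, p ::ₘ (g.pcs + h.pcs),
    g.nw + h.nw + (trig p).toNat⟩

/-- **An outcome of the run of one component**: the product of the contraction weights, the `χ′`-directions produced
(earliest first), the number of vertices differentiated down and the pieces used IN THIS RUN, the component once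
complete, the untouched observables and the untouched complete components. [cite: BalabanImbrieJaffe1988, §5.14 p.311–312] -/
structure WOut (S κ ι P : Type) where
  /-- product of the contraction weights of the run -/
  a : ℝ
  /-- directions of the contractions to `χ′` made in the run, earliest first -/
  D : List (S → ℝ)
  /-- number of vertices differentiated down in the run -/
  dv : ℕ
  /-- covariance pieces used in the run (with multiplicity) -/
  dp : Multiset P
  /-- the component, complete -/
  g : WGrp S κ ι P
  /-- observables not touched -/
  rest : Finset κ
  /-- complete components set aside earlier and not touched -/
  done : Multiset (WGrp S κ ι P)

/-- Record an earlier contraction through the piece `p` with weight `w` (bookkeeping). [cite: BalabanImbrieJaffe1988, §5.14 p.311] -/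
@[simps] def WOut.scale (p : P) (w : ℝ) (o : WOut S κ ι P) : WOut S κ ι P :=
  { o with a := w * o.a, dp := p ::ₘ o.dp }

/-- Record an earlier contraction to `χ′` through the piece `p`, direction `z` (bookkeeping). [cite: BalabanImbrieJaffe1988, §5.14 p.311] -/
@[simps] def WOut.push (p : P) (z : S → ℝ) (o : WOut S κ ι P) : WOut S κ ι P :=
  { o with D := z :: o.D, dp := p ::ₘ o.dp }

/-- Record an earlier vertex (bookkeeping). [cite: BalabanImbrieJaffe1988, §5.14 p.311] -/
@[simps] def WOut.bump (o : WOut S κ ι P) : WOut S κ ι P := { o with dv := o.dv + 1 }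

/-! ## §2  The potential and the run -/

/-- The termination potential of a run: pending legs of the component (+1, + the arity budget of the vertices it may
still differentiate down), the legs of the untouched observables, the pending legs of the complete components.
[cite: BalabanImbrieJaffe1988, §5.14 p.311] -/
def rpot (obs : κ → List (S → ℝ)) (M A : ℕ) (g : WGrp S κ ι P) (rest : Finset κ) (done : Multiset (WGrp S κ ι P)) : ℕ :=
  g.pend.length + 1 + (M - Multiset.card g.vxs) * A + (∑ j ∈ rest, (obs j).length)
    + (done.map fun h => h.pend.length).sum

section Pot

variable (obs : κ → List (S → ℝ)) (M A : ℕ) {g : WGrp S κ ι P} {u : S → ℝ} {L : List (S → ℝ)}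
  (rest : Finset κ) (done : Multiset (WGrp S κ ι P))

omit [Fintype S] [Fintype ι] [Fintype P] in
/-- (1) a contraction inside the component lowers the potential. [cite: BalabanImbrieJaffe1988, §5.14 p.311] -/
theorem rpot_pair (hp : g.pend = u :: L) (i : ℕ) (pcs : Multiset P) (nw : ℕ) :
    rpot obs M A ⟨L.eraseIdx i, g.nchi, g.vxs, g.lab, pcs, nw⟩ rest done < rpot obs M A g rest done := by
  have := List.length_eraseIdx_le L i
  simp only [rpot, hp, List.length_cons]
  omega

omit [Fintype S] [Fintype ι] [Fintype P] in
/-- (2) joining a pristine observable lowers the potential. [cite: BalabanImbrieJaffe1988, §5.14 p.311] -/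
theorem rpot_pristine [DecidableEq κ] (hp : g.pend = u :: L) {j : κ} (hj : j ∈ rest) (i : ℕ) (lab' : Finset κ)
    (pcs : Multiset P) (nw : ℕ) :
    rpot obs M A ⟨L ++ (obs j).eraseIdx i, g.nchi, g.vxs, lab', pcs, nw⟩ (rest.erase j) done
      < rpot obs M A g rest done := by
  have h1 := List.length_eraseIdx_le (obs j) i
  have h2 := Finset.add_sum_erase rest (fun j => (obs j).length) hj
  simp only [rpot, hp, List.length_cons, List.length_append]
  omega

omit [Fintype S] [Fintype ι] [Fintype P] in
/-- (3) joining a complete component lowers the potential. [cite: BalabanImbrieJaffe1988, §5.14 p.311] -/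
theorem rpot_absorb [DecidableEq κ] (trig : P → Bool) (hp : g.pend = u :: L) {h : WGrp S κ ι P} (hh : h ∈ done)
    (i : ℕ) (p : P) :
    rpot obs M A (WGrp.absorb trig L g h i p) rest (done.erase h) < rpot obs M A g rest done := by
  have h1 := List.length_eraseIdx_le h.pend i
  have h2 : (done.map fun h => h.pend.length).sum
      = h.pend.length + ((done.erase h).map fun h => h.pend.length).sum := by
    conv_lhs => rw [← Multiset.cons_erase hh]
    rw [Multiset.map_cons, Multiset.sum_cons]
  have h3 : (M - Multiset.card (g.vxs + h.vxs)) * A ≤ (M - Multiset.card g.vxs) * A :=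
    Nat.mul_le_mul_right _ (Nat.sub_le_sub_left (by rw [Multiset.card_add]; exact Nat.le_add_right _ _) _)
  simp only [rpot, hp, List.length_cons, WGrp.absorb, List.length_append]
  omega

omit [Fintype S] [Fintype ι] [Fintype P] in
/-- (4)/(5) a contraction to the source or to `χ′` lowers the potential. [cite: BalabanImbrieJaffe1988, §5.14 p.311] -/
theorem rpot_drop (hp : g.pend = u :: L) (n : ℕ) (pcs : Multiset P) (nw : ℕ) :
    rpot obs M A ⟨L, n, g.vxs, g.lab, pcs, nw⟩ rest done < rpot obs M A g rest done := by
  simp only [rpot, hp, List.length_cons]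
  omega

omit [Fintype S] [Fintype P] in
/-- (6) differentiating down a vertex (fewer than `M` so far) lowers the potential. [cite: BalabanImbrieJaffe1988, §5.14 p.311] -/
theorem rpot_vertex (legs : ι → List (S → ℝ)) (hp : g.pend = u :: L) (hnv : Multiset.card g.vxs < M) (m : ι) (j : ℕ)
    (pcs : Multiset P) (nw : ℕ) :
    rpot obs M (maxArity legs) ⟨L ++ (legs m).eraseIdx j, g.nchi, m ::ₘ g.vxs, g.lab, pcs, nw⟩ rest done
      < rpot obs M (maxArity legs) g rest done := by
  have e : M - Multiset.card g.vxs = (M - (Multiset.card g.vxs + 1)) + 1 := by omega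
  have h1 := List.length_eraseIdx_le (legs m) j
  have h2 := length_legs_le legs m
  simp only [rpot, hp, List.length_cons, List.length_append, Multiset.card_cons, e, Nat.add_mul, one_mul]
  omega

end Pot

omit [Fintype S] [Fintype ι] [Fintype P] in
/-- An incomplete component has differentiated down fewer than `M` vertices. [cite: BalabanImbrieJaffe1988, §5.14 p.311] -/
theorem WGrp.nv_lt_of_not_complete {M : ℕ} {g : WGrp S κ ι P} (hc : ¬ g.complete M = true) :
    Multiset.card g.vxs < M := by
  simp only [WGrp.complete, Bool.or_eq_true, decide_eq_true_eq, not_or, not_le] at hc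
  exact hc.1.2

omit [Fintype S] [Fintype ι] [Fintype P] in
/-- An incomplete component has a pending leg. [cite: BalabanImbrieJaffe1988, §5.14 p.311] -/
theorem WGrp.pend_ne_nil_of_not_complete {M : ℕ} {g : WGrp S κ ι P} (hc : ¬ g.complete M = true) : g.pend ≠ [] := by
  simp only [WGrp.complete, Bool.or_eq_true, decide_eq_true_eq, not_or, List.isEmpty_iff] at hc
  exact hc.1.1.1

variable [DecidableEq κ]

/-- **THE RUN OF ONE COMPONENT WITH THE COVARIANCE SPLIT** (p. 311): follow the component `g` in the environment
(`rest` = untouched observables, `done` = complete components set aside) until it is complete — *"We stop integrating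
by parts fields in complete components of X"* — and return every outcome.  If `g` is complete: the single outcome "set
aside".  Otherwise its head leg `Φ(u)` is integrated by parts and, *"after each integration by parts, we replace the
covariance by C_loc … and give a random walk expansion for the difference"*: FOR EVERY PIECE `p` (covariance `Cov p`)
it contracts (1) to another pending leg of `g`; (2) to the `i`-th leg of a pristine observable `j ∈ rest`, which JOINS;
(3) to the `i`-th pending leg of a complete component `h ∈ done`, which JOINS; (4) to the source `ℱ`; (5) to `χ′`
(direction `Cov p u` recorded; complete); (6) to the vertex `m` through its leg `j` (its other legs join, `m`
recorded).  Every event records `p` and adds `trig p` to the random-walk count: *"if a term from the random walk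
expansion occurs"* the component is complete.  Well-founded on `rpot`. [cite: BalabanImbrieJaffe1988, §5.14 p.311] -/
def run (Cov : P → Matrix S S ℝ) (trig : P → Bool) (f : S → ℝ) (c : ι → ℝ) (legs : ι → List (S → ℝ))
    (obs : κ → List (S → ℝ)) (M : ℕ) :
    WGrp S κ ι P → Finset κ → Multiset (WGrp S κ ι P) → Multiset (WOut S κ ι P)
  | g, rest, done =>
    if _hc : g.complete M = true then {⟨1, [], 0, 0, g, rest, done⟩}
    else
      match _hp : g.pend with
      | [] => 0
      | u :: L =>
        (univ : Finset P).val.bind fun p =>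
          -- (1) to another pending leg of the same component
          ((range L.length).val.bind fun i =>
            (run Cov trig f c legs obs M ⟨L.eraseIdx i, g.nchi, g.vxs, g.lab, p ::ₘ g.pcs, g.nw + (trig p).toNat⟩
                rest done).map (WOut.scale p ((Cov p *ᵥ u) ⬝ᵥ L.getD i 0)))
          -- (2) to a leg of a pristine observable: it joins the component
          + (fbind rest fun j _hj => (range (obs j).length).val.bind fun i =>
              (run Cov trig f c legs obs M
                  ⟨L ++ (obs j).eraseIdx i, g.nchi, g.vxs, g.lab ∪ {j}, p ::ₘ g.pcs, g.nw + (trig p).toNat⟩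
                  (rest.erase j) done).map (WOut.scale p ((Cov p *ᵥ u) ⬝ᵥ (obs j).getD i 0)))
          -- (3) to a pending leg of a complete component set aside: it joins the component
          + (mbind done fun h _hh => (range h.pend.length).val.bind fun i =>
              (run Cov trig f c legs obs M (WGrp.absorb trig L g h i p) rest (done.erase h)).map
                (WOut.scale p ((Cov p *ᵥ u) ⬝ᵥ h.pend.getD i 0)))
          -- (4) to the source
          + (run Cov trig f c legs obs M ⟨L, g.nchi, g.vxs, g.lab, p ::ₘ g.pcs, g.nw + (trig p).toNat⟩ rest done).map
              (WOut.scale p ((Cov p *ᵥ u) ⬝ᵥ f))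
          -- (5) to χ′
          + (run Cov trig f c legs obs M ⟨L, g.nchi + 1, g.vxs, g.lab, p ::ₘ g.pcs, g.nw + (trig p).toNat⟩ rest done).map
              (WOut.push p (Cov p *ᵥ u))
          -- (6) to the interaction: a vertex differentiated down, its other legs join the component
          + ((univ : Finset ι).val.bind fun m => (range (legs m).length).val.bind fun j =>
              (run Cov trig f c legs obs M
                  ⟨L ++ (legs m).eraseIdx j, g.nchi, m ::ₘ g.vxs, g.lab, p ::ₘ g.pcs, g.nw + (trig p).toNat⟩
                  rest done).map
                fun o => (o.scale p (-(c m * ((Cov p *ᵥ u) ⬝ᵥ (legs m).getD j 0)))).bump)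
  termination_by g rest done => rpot obs M (maxArity legs) g rest done
  decreasing_by
    · exact rpot_pair obs M _ rest done _hp i _ _
    · exact rpot_pristine obs M _ rest done _hp _hj i _ _ _
    · exact rpot_absorb obs M _ rest done trig _hp _hh i p
    · exact rpot_drop obs M _ rest done _hp _ _ _
    · exact rpot_drop obs M _ rest done _hp _ _ _
    · exact rpot_vertex obs M rest done legs _hp (WGrp.nv_lt_of_not_complete _hc) m j _ _


/-! ## §2b  Unfolding the run; completeness bookkeeping -/

section Unfold

variable (Cov : P → Matrix S S ℝ) (trig : P → Bool) (f : S → ℝ) (c : ι → ℝ) (legs : ι → List (S → ℝ))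
  (obs : κ → List (S → ℝ)) (M : ℕ)

/-- Unfolding the run of a complete component: it is set aside. [cite: BalabanImbrieJaffe1988, §5.14 p.311] -/
theorem run_of_complete {g : WGrp S κ ι P} (hc : g.complete M = true) (rest : Finset κ)
    (done : Multiset (WGrp S κ ι P)) :
    run Cov trig f c legs obs M g rest done = {⟨1, [], 0, 0, g, rest, done⟩} := by
  rw [run, dif_pos hc]

/-- Unfolding the run of an incomplete component with head leg `u`: for every piece, the six contractions.
[cite: BalabanImbrieJaffe1988, §5.14 p.311] -/
theorem run_of_not_complete {g : WGrp S κ ι P} (hc : ¬ g.complete M = true) {u : S → ℝ} {L : List (S → ℝ)}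
    (hp : g.pend = u :: L) (rest : Finset κ) (done : Multiset (WGrp S κ ι P)) :
    run Cov trig f c legs obs M g rest done
      = (univ : Finset P).val.bind fun p =>
          ((range L.length).val.bind fun i =>
            (run Cov trig f c legs obs M ⟨L.eraseIdx i, g.nchi, g.vxs, g.lab, p ::ₘ g.pcs, g.nw + (trig p).toNat⟩
                rest done).map (WOut.scale p ((Cov p *ᵥ u) ⬝ᵥ L.getD i 0)))
          + (fbind rest fun j _hj => (range (obs j).length).val.bind fun i =>
              (run Cov trig f c legs obs M
                  ⟨L ++ (obs j).eraseIdx i, g.nchi, g.vxs, g.lab ∪ {j}, p ::ₘ g.pcs, g.nw + (trig p).toNat⟩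
                  (rest.erase j) done).map (WOut.scale p ((Cov p *ᵥ u) ⬝ᵥ (obs j).getD i 0)))
          + (mbind done fun h _hh => (range h.pend.length).val.bind fun i =>
              (run Cov trig f c legs obs M (WGrp.absorb trig L g h i p) rest (done.erase h)).map
                (WOut.scale p ((Cov p *ᵥ u) ⬝ᵥ h.pend.getD i 0)))
          + (run Cov trig f c legs obs M ⟨L, g.nchi, g.vxs, g.lab, p ::ₘ g.pcs, g.nw + (trig p).toNat⟩ rest done).map
              (WOut.scale p ((Cov p *ᵥ u) ⬝ᵥ f))
          + (run Cov trig f c legs obs M ⟨L, g.nchi + 1, g.vxs, g.lab, p ::ₘ g.pcs, g.nw + (trig p).toNat⟩ rest done).map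
              (WOut.push p (Cov p *ᵥ u))
          + ((univ : Finset ι).val.bind fun m => (range (legs m).length).val.bind fun j =>
              (run Cov trig f c legs obs M
                  ⟨L ++ (legs m).eraseIdx j, g.nchi, m ::ₘ g.vxs, g.lab, p ::ₘ g.pcs, g.nw + (trig p).toNat⟩
                  rest done).map
                fun o => (o.scale p (-(c m * ((Cov p *ᵥ u) ⬝ᵥ (legs m).getD j 0)))).bump) := by
  rw [run, dif_neg hc]
  split
  · rename_i h0
    rw [hp] at h0
    exact absurd h0 (List.cons_ne_nil _ _)
  · rename_i u' L' hp'
    rw [hp] at hp'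
    obtain ⟨rfl, rfl⟩ := List.cons_eq_cons.1 hp'
    rfl

end Unfold

omit [Fintype S] [Fintype ι] [Fintype P] [DecidableEq κ] in
/-- **"complete … if a term from the random walk expansion occurs"**: a component whose last contraction used a
triggering piece is complete. [cite: BalabanImbrieJaffe1988, §5.14 p.311] -/
theorem WGrp.complete_of_trig {trig : P → Bool} {p : P} (hp : trig p = true) (M : ℕ) (L : List (S → ℝ)) (n : ℕ)
    (vxs : Multiset ι) (lab : Finset κ) (pcs : Multiset P) (nw : ℕ) :
    WGrp.complete M (⟨L, n, vxs, lab, pcs, nw + (trig p).toNat⟩ : WGrp S κ ι P) = true := by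
  simp only [WGrp.complete, hp, Bool.toNat_true, Bool.or_eq_true, decide_eq_true_eq]
  exact Or.inr (Nat.succ_pos _)

omit [Fintype S] [Fintype ι] [Fintype P] [DecidableEq κ] in
/-- A complete component is constant or a remainder component (the printed dichotomy `{X_c}` / `{X_r}`).
[cite: BalabanImbrieJaffe1988, §5.14 p.311] -/
theorem WGrp.isConst_or_isRem_of_complete {M : ℕ} {g : WGrp S κ ι P} (h : g.complete M = true) :
    g.IsConst M ∨ g.IsRem M := by
  simp only [WGrp.complete, Bool.or_eq_true, List.isEmpty_iff, decide_eq_true_eq] at h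
  by_cases hr : g.IsRem M
  · exact Or.inr hr
  · left
    simp only [WGrp.IsRem, not_or, not_lt, not_le, Nat.le_zero] at hr
    rcases h with ((h | h) | h) | h
    · exact ⟨h, hr.1, hr.2.1, hr.2.2⟩
    · exact absurd hr.1 (by omega)
    · exact absurd hr.2.1 (by omega)
    · exact absurd hr.2.2 (by omega)

omit [Fintype S] [Fintype ι] [Fintype P] [DecidableEq κ] in
/-- A remainder component is not constant. [cite: BalabanImbrieJaffe1988, §5.14 p.311] -/
theorem WGrp.not_isConst_of_isRem {M : ℕ} {g : WGrp S κ ι P} (h : g.IsRem M) : ¬ g.IsConst M := by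
  rintro ⟨-, h0, hlt, hw⟩
  rcases h with h | h | h <;> omega

omit [Fintype S] [Fintype ι] [Fintype P] [DecidableEq κ] in
/-- A constant component is complete. [cite: BalabanImbrieJaffe1988, §5.14 p.311] -/
theorem WGrp.complete_of_isConst {M : ℕ} {g : WGrp S κ ι P} (h : g.IsConst M) : g.complete M = true := by
  simp only [WGrp.complete, h.1, List.isEmpty_nil, Bool.true_or]

omit [Fintype S] [Fintype ι] [Fintype P] [DecidableEq κ] in
/-- A remainder component is complete. [cite: BalabanImbrieJaffe1988, §5.14 p.311] -/
theorem WGrp.complete_of_isRem {M : ℕ} {g : WGrp S κ ι P} (h : g.IsRem M) : g.complete M = true := by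
  simp only [WGrp.complete, Bool.or_eq_true, decide_eq_true_eq]
  rcases h with h | h | h
  · exact Or.inl (Or.inl (Or.inr h))
  · exact Or.inl (Or.inr h)
  · exact Or.inr h

omit [Fintype S] [Fintype ι] [Fintype P] [DecidableEq κ] in
/-- The pristine component of an observable with a leg is not complete (it will be integrated by parts); without legs
it is constant. [cite: BalabanImbrieJaffe1988, §5.14 p.311] -/
theorem pristine_complete_iff (obs : κ → List (S → ℝ)) {M : ℕ} (hM : 0 < M) (j : κ) :
    (pristine (ι := ι) (P := P) obs j).complete M = true ↔ obs j = [] := by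
  simp only [WGrp.complete, pristine, Bool.or_eq_true, List.isEmpty_iff, decide_eq_true_eq, Multiset.card_zero,
    lt_irrefl, or_false]
  constructor
  · rintro (h | h)
    · exact h
    · omega
  · exact fun h => Or.inl h

end Literature.MathematicalPhysics.QuantumFieldTheory.BalabanImbrieJaffe1984to88.BIJ88WalkRun311

end
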